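import Literature.Probability.RandomPlanarGeometry.SAWCountMonotoneOdd
import Literature.Probability.RandomPlanarGeometry.SAWCountMonotoneBothTrappedEven
import HarnessLib

/-!
# No walk is trapped at BOTH ends at an odd length `n ≤ 6d - 3`: the odd half of the both-trapped
# threshold, and the escape residual there consists of pocketed (untrapped) ends only

Sibling of `SAWCountMonotoneBothTrappedEven.lean` (even `n ≤ 8d - 6`) and sequel of
`SAWCountMonotoneOdd.lean` (no DOUBLY trapped walk — trapped end, at most ONE free start site — of odd
length `n ≤ 6d - 5`).  The odd count of that file (cage times of the trapped end `e = ω n` at even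
times, `m = (n+1)/2 - 2d` exceptional even times, at most two generic-or-final odd times next to `0`,
every other odd time next to `0` adjacent to an exceptional time) gives, for a COMPLETELY surrounded
start, `2d ≤ 2 + 2m = n + 3 - 4d`, i.e. only `6d - 3 ≤ n`.  The equality case `n = 6d - 3` is excluded by
one more unit of slack, found by looking at the visit of the antipode `-e`:

* if `e ≁ 0`, the time `0` is itself exceptional but is nobody's successor, so the special odd times
  whose LATER neighbour is exceptional number at most `m - 1`;
* if `e ∼ 0`, the start's neighbour `-e` is visited (the start is surrounded) at an odd time `j₀ < n`;
  the only common neighbour of `e` and `-e` is `0`, so `j₀` is not generic (both `ω (j₀ ± 1) ∼ e` would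
  put `0` at two times), and either both its even neighbours are exceptional (one special time counted
  twice), or `ω (j₀ + 1) = 0` (impossible), or `ω (j₀ - 1) = 0`, i.e. `j₀ = 1` — and then the time `1`, the
  only possible generic time when `e ∼ 0`, is not generic.

Either way `2d + 1 ≤ 2 + 2m`, i.e. `6d - 2 ≤ n`, so for odd `n` in fact `6d - 1 ≤ n`:

* `bothTrapped_eq_empty_of_odd` : for odd `n` with `n + 3 ≤ 6d` no `n`-step self-avoiding walk on `ℤ^d`
  has `extCount ω n = 0` and `extCount (revWalk n ω) n = 0`;
* `one_le_extCount_of_mem_escapeResidual_of_odd` : at those lengths every walk of the escape residual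
  `R` (`SAWCountMonotoneEscape.lean`: doomed end, surrounded start) has an UNTRAPPED, pocketed end;
* `bothTrapped_eq_empty_of_threshold`, `one_le_extCount_of_mem_escapeResidual` : both parities together
  (odd `n ≤ 6d - 3`, even `n ≤ 8d - 6`, with `SAWCountMonotoneBothTrappedEven.lean`).

The bound is sharp in every dimension: `SAWCountMonotoneEscapeSharp.lean` has both-trapped walks at
every odd `n ≥ 6d - 1` (`bothTrappedWitness`), so the both-trapped onset is EXACTLY `6d - 1` (odd) and
`8d - 4` (even, `SAWCountMonotoneEscapeSharpEven.lean` / `…BothTrappedEven.lean`), two steps after the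
doubly-trapped onsets `6d - 3` / `8d - 6` of `doublyTrapped_eq_empty_iff`.  Exhaustive enumeration (lane
«pcv-sawmu» a-p4 g26, kit j306921 / j307755 / j307756; not used in proofs): `#R(2, n) = 0` for `n ≤ 10`,
`R(3, 15) = R(3, 16) = R(3, 18) = ∅`, `R(4, n) = ∅` for `n ≤ 21`.

[cite: MadrasSlade1993, §1.2 p. 10 (parity), §7.1 p. 231] [cite: BDGS2012, §1.3 (`cₙ ≤ cₙ₊₁`, O'Brien 1990)]
-/

noncomputable section

open Literature.Probability.LatticeModels Literature.Probability.Percolation SimpleGraph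

namespace Literature.Probability.RandomPlanarGeometry.SAW.Zd

variable {d : ℕ}

/-- A neighbour of the origin is not its own antipode. [cite: MadrasSlade1993, §1.1] -/
theorem ne_neg_of_adj_zero {e : Site d} (he : (zdGraph d).Adj 0 e) : e ≠ -e := by
  intro h
  have he0 : e = 0 := by
    funext i
    have := congrFun h i
    simp only [Pi.neg_apply] at this
    show e i = 0
    omega
  exact he.ne he0.symm

/-- The antipode of a neighbour of the origin is a neighbour of the origin. [cite: MadrasSlade1993, §1.1] -/
theorem adj_zero_neg_of_adj_zero {e : Site d} (he : (zdGraph d).Adj 0 e) : (zdGraph d).Adj 0 (-e) := by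
  have := (zdGraph_adj_add_right 0 e (-e)).2 he
  rw [zero_add, add_neg_cancel] at this
  exact this.symm

/-- The only common neighbour of a neighbour `e` of the origin and its antipode `-e` is the origin.
[cite: MadrasSlade1993, §1.1] -/
theorem eq_zero_of_adj_of_adj_neg {e z : Site d} (he : (zdGraph d).Adj 0 e) (h1 : (zdGraph d).Adj e z)
    (h2 : (zdGraph d).Adj z (-e)) : z = 0 := by
  rcases eq_or_eq_of_adj_adj (ne_neg_of_adj_zero he) he.symm (adj_zero_neg_of_adj_zero he) h1 h2
    with h | h
  · exact h
  · rw [h, add_neg_cancel, zero_sub, neg_zero]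

open Classical in
/-- **No walk trapped at both ends at an odd length `n ≤ 6d - 3`.** If `n` is odd and both
`extCount ω n = 0` and `extCount (revWalk n ω) n = 0`, then `6d - 1 ≤ n`: the odd count of
`doublyTrapped_eq_empty_of_odd` with a completely surrounded start, plus one unit of slack from the
visit of the antipode `-e` of the end (module docstring). [cite: MadrasSlade1993, §1.2, p. 10; §7.1]
[cite: BDGS2012, §1.3] -/
theorem bothTrapped_eq_empty_of_odd {n : ℕ} (hodd : Odd n) (hn : n + 3 ≤ 6 * d) :
    ((saws d n).filter fun ω => extCount ω n = 0 ∧ extCount (revWalk n ω) n = 0) = ∅ := by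
  classical
  refine Finset.eq_empty_of_forall_notMem fun ω hωT => ?_
  obtain ⟨hω, h0, h1⟩ := Finset.mem_filter.1 hωT
  obtain ⟨h00, -, hadj, hinj⟩ := mem_saws.1 hω
  have hn2 : n % 2 = 1 := Nat.odd_iff.1 hodd
  have hn7 : 4 * d ≤ n + 1 := four_mul_le_of_extCount_eq_zero hω h0
  have hinj' : ∀ i ≤ n, ∀ j ≤ n, ω i = ω j → i = j := fun i hi j hj h =>
    hinj (show i ∈ {i | i ≤ n} from hi) (show j ∈ {i | i ≤ n} from hj) h
  -- even times `< n`: cage times `EN` of the trapped end and exceptional times `X`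
  set P := (Finset.range n).filter fun i => i % 2 = 0 with hP
  set EN := P.filter fun i => (zdGraph d).Adj (ω n) (ω i) with hEN
  set X := P.filter fun i => ¬ (zdGraph d).Adj (ω n) (ω i) with hX
  have hPcard : P.card ≤ (n + 1) / 2 := card_filter_range_even_le n
  have hENX : EN.card + X.card = P.card := by
    rw [hEN, hX, Finset.card_filter_add_card_filter_not]
  have hENcard : 2 * d ≤ EN.card := by
    have hsub : nbrs (ω n) ⊆ EN.image ω := by
      intro y hy
      have hy' := mem_nbrs.1 hy
      have hvis : ∃ i ≤ n, ω i = y := by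
        by_contra h
        have : y ∈ freeNbrs ω n := mem_freeNbrs.2 ⟨hy', fun i hi hiy => h ⟨i, hi, hiy⟩⟩
        rw [extCount, Finset.card_eq_zero] at h0
        rw [h0] at this
        exact Finset.notMem_empty y this
      obtain ⟨i, hi, rfl⟩ := hvis
      have hin : i ≠ n := fun h => hy'.ne (by rw [h])
      have hpar := odd_add_of_adj_apply hω hi hy'
      refine Finset.mem_image.2 ⟨i, ?_, rfl⟩
      rw [hEN, Finset.mem_filter, hP, Finset.mem_filter, Finset.mem_range]
      exact ⟨⟨by omega, by omega⟩, hy'⟩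
    calc 2 * d = (nbrs (ω n)).card := (card_nbrs _).symm
      _ ≤ (EN.image ω).card := Finset.card_le_card hsub
      _ ≤ EN.card := Finset.card_image_le
  -- the visited neighbours of the start (all of them) and their (odd) times `B`
  set U := (nbrs (ω 0)).filter fun z => ∀ i ≤ n, ω i ≠ z with hU
  set W := (nbrs (ω 0)).filter fun z => ¬ ∀ i ≤ n, ω i ≠ z with hW
  have hUW : U.card + W.card = 2 * d := by
    rw [hU, hW, Finset.card_filter_add_card_filter_not, card_nbrs]
  have hU0 : U.card ≤ 0 := (card_filter_nbrs_start_le_extCount_revWalk hω).trans h1.le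
  have hvis0 : ∀ z, (zdGraph d).Adj (ω 0) z → ∃ i ≤ n, ω i = z := fun z hz => by
    by_contra h
    have : 0 < U.card :=
      Finset.card_pos.2 ⟨z, Finset.mem_filter.2 ⟨mem_nbrs.2 hz, fun i hi hiz => h ⟨i, hi, hiz⟩⟩⟩
    omega
  set B := (Finset.range (n + 1)).filter fun j => (zdGraph d).Adj (ω 0) (ω j) with hB
  have hBmem : ∀ j ∈ B, j ≤ n ∧ j % 2 = 1 ∧ (zdGraph d).Adj (ω 0) (ω j) := by
    intro j hj
    rw [hB, Finset.mem_filter, Finset.mem_range] at hj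
    have hpar := odd_add_of_adj_apply_apply hω (Nat.zero_le n) (by omega : j ≤ n) hj.2
    exact ⟨by omega, by omega, hj.2⟩
  have hWB : W.card ≤ B.card := by
    have hsub : W ⊆ B.image ω := by
      intro z hz
      rw [hW, Finset.mem_filter] at hz
      obtain ⟨hz, hvis⟩ := hz
      have hex : ∃ i ≤ n, ω i = z := by
        by_contra h; exact hvis fun i hi hiz => h ⟨i, hi, hiz⟩
      obtain ⟨j, hj, rfl⟩ := hex
      refine Finset.mem_image.2 ⟨j, ?_, rfl⟩
      rw [hB, Finset.mem_filter, Finset.mem_range]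
      exact ⟨by omega, mem_nbrs.1 hz⟩
    exact (Finset.card_le_card hsub).trans Finset.card_image_le
  -- split `B`: the final time `n`, generic times, special times
  set Bf := B.filter fun j => ¬ j < n with hBf
  set Bl := B.filter fun j => j < n with hBl
  have hBsplit : Bl.card + Bf.card = B.card := by
    rw [hBl, hBf, Finset.card_filter_add_card_filter_not]
  set G := Bl.filter fun j => (zdGraph d).Adj (ω n) (ω (j - 1)) ∧ (zdGraph d).Adj (ω n) (ω (j + 1))
    with hG
  set Sp := Bl.filter fun j =>
    ¬ ((zdGraph d).Adj (ω n) (ω (j - 1)) ∧ (zdGraph d).Adj (ω n) (ω (j + 1))) with hSp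
  have hBlsplit : G.card + Sp.card = Bl.card := by
    rw [hG, hSp, Finset.card_filter_add_card_filter_not]
  -- special times sit next to exceptional even times: at most `2 #X` of them
  set Sp₁ := Bl.filter fun j => ¬ (zdGraph d).Adj (ω n) (ω (j - 1)) with hSp₁
  set Sp₂ := Bl.filter fun j => ¬ (zdGraph d).Adj (ω n) (ω (j + 1)) with hSp₂
  have hBlmem : ∀ j ∈ Bl, j < n ∧ j % 2 = 1 ∧ (zdGraph d).Adj (ω 0) (ω j) := by
    intro j hj
    rw [hBl, Finset.mem_filter] at hj
    obtain ⟨-, hpar, ha⟩ := hBmem j hj.1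
    exact ⟨hj.2, hpar, ha⟩
  have hSpsub : Sp ⊆ Sp₁ ∪ Sp₂ := by
    intro j hj
    rw [hSp, Finset.mem_filter, not_and_or] at hj
    rcases hj.2 with h | h
    · exact Finset.mem_union_left _ (Finset.mem_filter.2 ⟨hj.1, h⟩)
    · exact Finset.mem_union_right _ (Finset.mem_filter.2 ⟨hj.1, h⟩)
  have hSpU : Sp.card + (Sp₁ ∩ Sp₂).card ≤ Sp₁.card + Sp₂.card := by
    have := Finset.card_le_card hSpsub
    have := Finset.card_union_add_card_inter Sp₁ Sp₂
    omega
  have hSp₁X : Sp₁.card ≤ X.card := by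
    refine Finset.card_le_card_of_injOn (fun j => j - 1) (fun j hj => ?_) ?_
    · rw [Finset.mem_coe, hSp₁, Finset.mem_filter] at hj
      obtain ⟨hjn, hpar, -⟩ := hBlmem j hj.1
      show j - 1 ∈ (X : Set ℕ)
      rw [Finset.mem_coe, hX, Finset.mem_filter, hP, Finset.mem_filter, Finset.mem_range]
      exact ⟨⟨by omega, by omega⟩, hj.2⟩
    · intro j hj j' hj' h
      rw [Finset.mem_coe, hSp₁, Finset.mem_filter] at hj hj'
      have := (hBlmem j hj.1).2.1
      have := (hBlmem j' hj'.1).2.1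
      simp only at h; omega
  have hSp₂X : Sp₂.card ≤ (X.erase 0).card := by
    refine Finset.card_le_card_of_injOn (fun j => j + 1) (fun j hj => ?_) ?_
    · rw [Finset.mem_coe, hSp₂, Finset.mem_filter] at hj
      obtain ⟨hjn, hpar, -⟩ := hBlmem j hj.1
      show j + 1 ∈ ((X.erase 0 : Finset ℕ) : Set ℕ)
      rw [Finset.mem_coe, Finset.mem_erase, hX, Finset.mem_filter, hP, Finset.mem_filter,
        Finset.mem_range]
      exact ⟨by omega, ⟨by omega, by omega⟩, hj.2⟩
    · intro j _ j' _ h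
      simpa using h
  -- generic times (and the final time when `ω n ∼ 0`)
  have hGmem : ∀ j ∈ G, j < n ∧ j % 2 = 1 ∧ (zdGraph d).Adj (ω 0) (ω j) ∧
      (zdGraph d).Adj (ω n) (ω (j - 1)) ∧ (zdGraph d).Adj (ω n) (ω (j + 1)) := by
    intro j hj
    rw [hG, Finset.mem_filter] at hj
    obtain ⟨hjn, hpar, ha⟩ := hBlmem j hj.1
    exact ⟨hjn, hpar, ha, hj.2.1, hj.2.2⟩
  have hBf1 : Bf.card ≤ 1 := by
    refine (Finset.card_le_card fun j hj => ?_).trans (Finset.card_singleton n).le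
    rw [hBf, Finset.mem_filter] at hj
    have := (hBmem j hj.1).1
    exact Finset.mem_singleton.2 (by omega)
  by_cases h0n : (zdGraph d).Adj (ω 0) (ω n)
  · -- `e ∼ 0`: the only possible generic time is `j = 1`
    have hG1 : ∀ j ∈ G, j = 1 := by
      intro j hj
      obtain ⟨hjn, hpar, ha, hm, hp⟩ := hGmem j hj
      obtain ⟨k, rfl⟩ : ∃ k, j = k + 1 := ⟨j - 1, by omega⟩
      simp only [Nat.add_sub_cancel] at hm
      by_contra hk1
      have hxy : ω n ≠ ω (k + 1) := fun h => by
        have := hinj' n le_rfl (k + 1) (by omega) h; omega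
      have hzk : (zdGraph d).Adj (ω k) (ω (k + 1)) := hadj k (by omega)
      have hzk2 : (zdGraph d).Adj (ω (k + 1 + 1)) (ω (k + 1)) := (hadj (k + 1) (by omega)).symm
      rcases eq_or_eq_of_adj_adj hxy h0n.symm ha hm hzk with h | h
      · have := hinj' k (by omega) 0 (Nat.zero_le n) h; omega
      rcases eq_or_eq_of_adj_adj hxy h0n.symm ha hp hzk2 with h' | h'
      · have := hinj' (k + 1 + 1) (by omega) 0 (Nat.zero_le n) h'; omega
      · have := hinj' k (by omega) (k + 1 + 1) (by omega) (h.trans h'.symm); omega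
    have hGcard : G.card ≤ 1 :=
      (Finset.card_le_card fun j hj => Finset.mem_singleton.2 (hG1 j hj)).trans
        (Finset.card_singleton 1).le
    -- the antipode `-e` of the end is a visited neighbour of the start, at an odd time `j₀ < n`
    have he : (zdGraph d).Adj 0 (ω n) := h00 ▸ h0n
    have hnege : (zdGraph d).Adj (ω 0) (-ω n) := by
      rw [h00]; exact adj_zero_neg_of_adj_zero he
    obtain ⟨j₀, hj₀n, hj₀⟩ := hvis0 _ hnege
    have hj₀B : j₀ ∈ B := by
      rw [hB, Finset.mem_filter, Finset.mem_range]
      exact ⟨by omega, by rw [hj₀]; exact hnege⟩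
    obtain ⟨-, hj₀par, -⟩ := hBmem j₀ hj₀B
    have hj₀lt : j₀ < n := by
      rcases Nat.lt_or_ge j₀ n with h | h
      · exact h
      · exfalso
        have hjn : j₀ = n := by omega
        rw [hjn] at hj₀
        exact ne_neg_of_adj_zero he hj₀
    have hj₀Bl : j₀ ∈ Bl := Finset.mem_filter.2 ⟨hj₀B, hj₀lt⟩
    -- a time next to `j₀` whose site is adjacent to `e` carries the origin
    have hzero : ∀ i ≤ n, (zdGraph d).Adj (ω n) (ω i) → (zdGraph d).Adj (ω i) (ω j₀) → i = 0 := by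
      intro i hi h1 h2
      have : ω i = 0 := eq_zero_of_adj_of_adj_neg he h1 (by rw [← hj₀]; exact h2)
      exact hinj' i hi 0 (Nat.zero_le n) (this.trans h00.symm)
    have hj₀G : j₀ ∉ G := by
      intro hj
      obtain ⟨-, -, -, hm, hp⟩ := hGmem j₀ hj
      have h1 : j₀ - 1 = 0 := hzero (j₀ - 1) (by omega) hm (by
        have := hadj (j₀ - 1) (by omega)
        rwa [show j₀ - 1 + 1 = j₀ by omega] at this)
      have h2 : j₀ + 1 = 0 := hzero (j₀ + 1) (by omega) hp (hadj j₀ (by omega)).symm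
      omega
    have hj₀Sp : j₀ ∈ Sp := by
      rw [hSp, Finset.mem_filter]
      refine ⟨hj₀Bl, fun h => hj₀G ?_⟩
      rw [hG, Finset.mem_filter]
      exact ⟨hj₀Bl, h⟩
    -- the slack
    have hkey : B.card + 1 ≤ 2 + 2 * X.card := by
      by_cases hs₁ : (zdGraph d).Adj (ω n) (ω (j₀ - 1))
      · -- then `ω (j₀ - 1) = 0`, `j₀ = 1`, and the time `1` is special, not generic: `G = ∅`
        have h1 : j₀ - 1 = 0 := hzero (j₀ - 1) (by omega) hs₁ (by
          have := hadj (j₀ - 1) (by omega)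
          rwa [show j₀ - 1 + 1 = j₀ by omega] at this)
        have hj₀1 : j₀ = 1 := by omega
        have hG0 : G.card = 0 := by
          rw [Finset.card_eq_zero, Finset.eq_empty_iff_forall_notMem]
          intro j hj
          have := hG1 j hj
          rw [this, ← hj₀1] at hj
          exact hj₀G hj
        have := Finset.card_erase_le (s := X) (a := 0)
        omega
      · by_cases hs₂ : (zdGraph d).Adj (ω n) (ω (j₀ + 1))
        · -- then `ω (j₀ + 1) = 0`: impossible
          exfalso
          have := hzero (j₀ + 1) (by omega) hs₂ (hadj j₀ (by omega)).symm
          omega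
        · -- both even neighbours of `j₀` are exceptional: `j₀ ∈ Sp₁ ∩ Sp₂`
          have hmem : j₀ ∈ Sp₁ ∩ Sp₂ :=
            Finset.mem_inter.2 ⟨Finset.mem_filter.2 ⟨hj₀Bl, hs₁⟩, Finset.mem_filter.2 ⟨hj₀Bl, hs₂⟩⟩
          have hpos : 1 ≤ (Sp₁ ∩ Sp₂).card := Finset.card_pos.2 ⟨j₀, hmem⟩
          have := Finset.card_erase_le (s := X) (a := 0)
          omega
    omega
  · -- `e ≁ 0`: no final time, at most two generic times, and the time `0` is exceptional
    have hBf0 : Bf.card = 0 := by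
      rw [Finset.card_eq_zero, Finset.eq_empty_iff_forall_notMem]
      intro j hj
      rw [hBf, Finset.mem_filter] at hj
      obtain ⟨hjle, -, ha⟩ := hBmem j hj.1
      have : j = n := by omega
      subst this
      exact h0n ha
    have hne0 : ω n ≠ 0 := fun h => by
      have := hinj' n le_rfl 0 (Nat.zero_le n) (h.trans h00.symm); omega
    have he2 : 2 ≤ normOne (ω n) := by
      by_contra hlt
      rcases Nat.lt_or_ge (normOne (ω n)) 1 with h | h
      · exact hne0 (normOne_eq_zero_iff.1 (by omega))
      · exact h0n (by rw [h00]; exact adj_zero_iff_normOne_eq_one.2 (by omega))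
    have h0X : 0 ∈ X := by
      rw [hX, Finset.mem_filter, hP, Finset.mem_filter, Finset.mem_range]
      refine ⟨⟨by omega, by omega⟩, fun h => h0n ?_⟩
      exact h.symm
    have hXe : (X.erase 0).card + 1 = X.card := Finset.card_erase_add_one h0X
    set Q := (nbrs (ω n)).filter fun x => normOne x ≤ 2 with hQ
    have hQ3 : Q.card ≤ 3 := card_filter_nbrs_normOne_le_two_le he2
    have hnormj : ∀ j ∈ G, normOne (ω j) = 1 := by
      intro j hj
      exact adj_zero_iff_normOne_eq_one.1 (h00 ▸ (hGmem j hj).2.2.1)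
    have hQmem : ∀ j ∈ G, ω (j - 1) ∈ Q ∧ ω (j + 1) ∈ Q := by
      intro j hj
      obtain ⟨hjn, hpar, ha, hm, hp⟩ := hGmem j hj
      have h1 := hnormj j hj
      obtain ⟨k, rfl⟩ : ∃ k, j = k + 1 := ⟨j - 1, by omega⟩
      simp only [Nat.add_sub_cancel] at hm ⊢
      have hsm := normOne_adj_cases ((hadj k (by omega)).symm)
      have hsp := normOne_adj_cases (hadj (k + 1) (by omega))
      exact ⟨Finset.mem_filter.2 ⟨mem_nbrs.2 hm, by omega⟩,
        Finset.mem_filter.2 ⟨mem_nbrs.2 hp, by omega⟩⟩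
    have hG2 : G.card ≤ 2 := by
      rcases G.eq_empty_or_nonempty with hGe | hGne
      · rw [hGe]; simp
      set j₀ := G.min' hGne with hj₀
      have hj₀mem : j₀ ∈ G := Finset.min'_mem G hGne
      have hj₀le : ∀ j ∈ G, j₀ ≤ j := fun j hj => Finset.min'_le G j hj
      set S := insert (ω (j₀ - 1)) (G.image fun j => ω (j + 1)) with hS
      have hSQ : S ⊆ Q := by
        intro x hx
        rw [hS, Finset.mem_insert] at hx
        rcases hx with rfl | hx
        · exact (hQmem j₀ hj₀mem).1
        · obtain ⟨j, hj, rfl⟩ := Finset.mem_image.1 hx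
          exact (hQmem j hj).2
      have hnot : ω (j₀ - 1) ∉ G.image fun j => ω (j + 1) := by
        intro hx
        obtain ⟨j, hj, hjx⟩ := Finset.mem_image.1 hx
        have hjn := (hGmem j hj).1
        have hj0n := (hGmem j₀ hj₀mem).1
        have := hinj' (j + 1) (by omega) (j₀ - 1) (by omega) hjx
        have := hj₀le j hj
        omega
      have hScard : S.card = G.card + 1 := by
        rw [hS, Finset.card_insert_of_notMem hnot, Finset.card_image_of_injOn]
        intro j hj j' hj' h
        rw [Finset.mem_coe] at hj hj'
        have := hinj' (j + 1) (by have := (hGmem j hj).1; omega) (j' + 1)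
          (by have := (hGmem j' hj').1; omega) h
        simpa using this
      have := Finset.card_le_card hSQ
      omega
    omega

/-- **At an odd length `n ≤ 6d - 3` every residual walk has a pocketed, untrapped end**: if
`ω ∈ escapeResidual d n` (doomed end, surrounded start) then `extCount ω n ≥ 1`. [cite: BDGS2012, §1.3] -/
theorem one_le_extCount_of_mem_escapeResidual_of_odd {n : ℕ} (hodd : Odd n) (hn : n + 3 ≤ 6 * d)
    {ω : ℕ → Site d} (hω : ω ∈ escapeResidual d n) : 1 ≤ extCount ω n := by
  classical
  obtain ⟨hs, -, hb⟩ := mem_escapeResidual.1 hω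
  by_contra h
  have ha : extCount ω n = 0 := by omega
  have hmem : ω ∈ (saws d n).filter (fun ω => extCount ω n = 0 ∧ extCount (revWalk n ω) n = 0) :=
    Finset.mem_filter.2 ⟨hs, ha, hb⟩
  rw [bothTrapped_eq_empty_of_odd hodd hn] at hmem
  exact Finset.notMem_empty ω hmem

/-! ### Both parities -/

open Classical in
/-- **The both-trapped emptiness half of the threshold law, both parities**: no `n`-step self-avoiding
walk on `ℤ^d` is trapped at both ends when `n` is odd with `n ≤ 6d - 3` or even with `n ≤ 8d - 6`
(`bothTrapped_eq_empty_of_odd`, `bothTrapped_eq_empty_of_even`); both bounds are attained two steps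
later (`SAWCountMonotoneEscapeSharp.lean`, `SAWCountMonotoneEscapeSharpEven.lean`).
[cite: MadrasSlade1993, §1.2, p. 10; §7.1] [cite: BDGS2012, §1.3] -/
theorem bothTrapped_eq_empty_of_threshold {n : ℕ}
    (h : (Odd n ∧ n + 3 ≤ 6 * d) ∨ (Even n ∧ n + 6 ≤ 8 * d)) :
    ((saws d n).filter fun ω => extCount ω n = 0 ∧ extCount (revWalk n ω) n = 0) = ∅ := by
  rcases h with ⟨hodd, hn⟩ | ⟨hev, hn⟩
  · exact bothTrapped_eq_empty_of_odd hodd hn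
  · exact bothTrapped_eq_empty_of_even hev hn

/-- **Below the both-trapped thresholds the escape residual consists of pocketed ends only**: for
`ω ∈ escapeResidual d n` with `n` odd `≤ 6d - 3` or even `≤ 8d - 6`, `extCount ω n ≥ 1` — the class a
pocket lemma must exclude to push O'Brien's inequality to these lengths by the escape route
`count_le_count_succ_of_escapeResidual_eq_empty`. [cite: BDGS2012, §1.3] -/
theorem one_le_extCount_of_mem_escapeResidual {n : ℕ}
    (h : (Odd n ∧ n + 3 ≤ 6 * d) ∨ (Even n ∧ n + 6 ≤ 8 * d))
    {ω : ℕ → Site d} (hω : ω ∈ escapeResidual d n) : 1 ≤ extCount ω n := by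
  rcases h with ⟨hodd, hn⟩ | ⟨hev, hn⟩
  · exact one_le_extCount_of_mem_escapeResidual_of_odd hodd hn hω
  · exact one_le_extCount_of_mem_escapeResidual_of_even hev hn hω

end Literature.Probability.RandomPlanarGeometry.SAW.Zd
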